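import Summits.QuantumFields.BalabanUV.T4Continuum.Support.VariationalVectorDivAvgCovariant
import Summits.QuantumFields.BalabanUV.T4Continuum.Support.VariationalVectorDivAvgFlat

/-!
# T⁴ programme, spine node NE2 (U1a), lane P2 — «V-AVG-G», file 8: DIV-AVG WITH BACKGROUND IN THE END's UNITS — `ε_D = √(3d)·(2∕n + m + n·m)` against
# `ρ_D = HESS♯ + GRAD♯ + qVV` (the square sums of file 7's pointwise bound: Cauchy–Schwarz, block bijection, translation invariance; model level; cell `pub-balaban`)

NE2 formalisation swarm `b2b-balaban-t4-ne2-formalise-*`, leaf prover 10 GEN 4 (`prover-b2b-balaban-t4-ne2-formalise-leaf-10-g4-0`, V-END holder lineage); item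
«V-AVG-G» (CLAIMS.log 2026-08-20 l.19093 ∕ l.19718 ∕ l.19946), file 8.  On top of file 7 (`norm_divAvg_cov_le`), file 6 (`sum_diag_le_hessV`), the road's counting
lemmas (`sq_sum_le_card_mul`, `sum_blocks_translate`) BY NAME; nothing defined.

THE STATEMENT.  Data as in file 7 (unitary `Rc`, `R′`, `T₀′`, product line carriers `lineT T₀′ R′`, FED⁺'s site mismatch `‖misv Rc R′ T₀′ y μ j‖ ≤ m` — the SAME datum as the
scalar Federbush `Scv_Q1v_le` and `harmApprox_colour`), fine 1-form `W` on `Tor (fine L N)`.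
 * §1 **`divAvg_cov_sq_le`** (lattice units):
   `Σ_y ‖div_{Rc}(Q_T W)(y) − L•Q_{T₀′}(div_{R′}W)(y)‖² ≤ 3·( 4d·L⁴(L^d)⁻¹·hessV R′ W + d·m²·L²(L^d)⁻¹·GD + d·m²·(L^d)⁻¹·nsqV W )`,
   `GD = Σ_μ Σ_x ‖(D_μW_μ)(x)‖²` (the diagonal first differences; `≤` the rough ∕ energy functionals of the class);
 * §2 **`divAvg_cov`** (END units, `N := fine n M`): `√((n^d)⁻¹n²)·‖toLp(div_{Rc}(Q_T W)) − toLp(L•Q_{T₀′}(div_{R′}W))‖ ≤ ε_D·√ρ_D` with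
   **`ε_D = √(3d)·(2·n⁻¹ + m + n·m)`**, **`ρ_D = ((nL)⁴∕(nL)^d)·hessV R′ W + ((nL)²∕(nL)^d)·GD + qVV n L M W`** — EXACTLY the `hDIV` binder of file 5's
   `avgG_projG_of_divAvg` with background (`m` = FED⁺'s site mismatch `misv`, which IS the product carriers' line mismatch in the line's own direction — file 7's
   `misL_lineT_self`).  In the road's plaquette class `n_k²·m_k ≤ c_m`, so `n_k·m_k → 0` geometrically (the same quantity that makes the curl Federbush defect
   `δ_k = √d·(n_k m_k)` decay) and `ε_D,k` decays geometrically: DIV-AVG WITH BACKGROUND IS A FIRST-ORDER LAW, and with file 5 the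
   (G″) socket of the vector END (`VariationalVectorEndOfLeavesAvgG`) is reduced to the scalar ∕ vector CLASSES alone — no displayed analytic statement of the lower
   bracket remains beyond the classes' V-REG ((GF3), `rhoV`, diagonal gradient) and the class condition on `m`.
At `m = 0` §1 is file 6's flat bound with the factor 3.

HONEST FRAMING (T4-DAG p. 1).  Model level (transports DATA, product carriers; c5); [folklore] counting; nothing printed is a hypothesis; no `def`, no `def … : Prop`, no
`sorry`; axioms standard.  The SIZE of `m` for the taxi class (its decay) is the class lineage's statement and is NOT proved here; the regularity functionals' V-REG at fine
minimisers is the END's displayed `hREGf`; V-END with background ∕ NE2 NOT proved; NE3 OPEN; spine PROVED 0∕9 unchanged; rung (B)+1 on a fixed finite T⁴ — NOT infinite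
volume, NOT mass gap, NOT Clay.  HONEST DEPENDENCY (cell, verbatim): continuum YM on T⁴ ⇐ BetaPertH ∧ nine spine estimates (0/9 proved); BetaPertH ⇐ (D1) ∧ (D4) ∧
CAP+tail; G-an2-4 gates asym, D1 and NE2/3/4.
-/

noncomputable section

namespace Summit.QuantumFields.BalabanUV.T4Continuum.VariationalVectorDivAvgCovariantSum

open Finset WithLp
open Literature.MathematicalPhysics.QuantumFieldTheory.Balaban1983to89.B5Prop11Plancherel (Tor fine unitVec)
open Literature.MathematicalPhysics.QuantumFieldTheory.Balaban1983to89.B5Block118 (tstep bpt)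
open Summit.QuantumFields.BalabanUV.T4Continuum.VariationalCovariantFederbush (sq_sum_le_card_mul sum_blocks_translate)
open Summit.QuantumFields.BalabanUV.T4Continuum.VariationalColourFederbush (cDv Qcv misv)
open Summit.QuantumFields.BalabanUV.T4Continuum.VariationalColourInterpolant (hessv hessv_nonneg)
open Summit.QuantumFields.BalabanUV.T4Continuum.VariationalVectorOneStep (hessV)
open Summit.QuantumFields.BalabanUV.T4Continuum.VectorBlockTrialForm (nsqV nsqV_nonneg QvL)
open Summit.QuantumFields.BalabanUV.T4Continuum.VariationalVectorForm (cdV qVV)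
open Summit.QuantumFields.BalabanUV.T4Continuum.VariationalVectorFederbush (lineT)
open Summit.QuantumFields.BalabanUV.T4Continuum.VariationalVectorWeitzenbock (divV)
open Summit.QuantumFields.BalabanUV.T4Continuum.VariationalVectorGaugeSlice (norm_toLp_sq)
open Summit.QuantumFields.BalabanUV.T4Continuum.VariationalVectorDivAvgFlat (sum_diag_le_hessV)
open Summit.QuantumFields.BalabanUV.T4Continuum.VariationalVectorDivAvgCovariant (norm_divAvg_cov_le)

variable {d : ℕ} {E : Type*} [NormedAddCommGroup E] [InnerProductSpace ℂ E] [CompleteSpace E]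
variable (L : ℕ) [NeZero L] (N : Fin d → ℕ) [hN : ∀ μ, NeZero (N μ)]
variable {Rc : Tor N → Fin d → (E →L[ℂ] E)} {R' : Tor (fine L N) → Fin d → (E →L[ℂ] E)} {T₀ : Tor (fine L N) → (E →L[ℂ] E)}

/-! ## §1 The square-sum bound in lattice units -/

/-- **DIV-AVG WITH BACKGROUND, SQUARE SUMS** (lattice units):
`Σ_y ‖div_{Rc}(Q_T W)(y) − L•Q_{T₀′}(div_{R′}W)(y)‖² ≤ 3·(4d·L⁴(L^d)⁻¹·hessV R′ W + d·m²·L²(L^d)⁻¹·Σ_μΣ_x‖(D_μW_μ)(x)‖² + d·m²·(L^d)⁻¹·nsqV W)`. [folklore] -/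
theorem divAvg_cov_sq_le (hRc : ∀ y μ, Rc y μ ∈ unitary (E →L[ℂ] E)) (hR' : ∀ x μ, R' x μ ∈ unitary (E →L[ℂ] E))
    (hT₀ : ∀ x, T₀ x ∈ unitary (E →L[ℂ] E)) {m : ℝ} (hmis : ∀ y μ j, ‖misv L N Rc R' T₀ y μ j‖ ≤ m)
    (W : Tor (fine L N) → Fin d → E) :
    ∑ y, ‖divV N Rc (QvL L N (lineT L N T₀ R') W) y - (L : ℂ) • Qcv L N T₀ (divV (fine L N) R' W) y‖ ^ 2
      ≤ 3 * (4 * d * (L : ℝ) ^ 4 * ((L : ℝ) ^ d)⁻¹ * hessV (fine L N) R' W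
          + d * m ^ 2 * (L : ℝ) ^ 2 * ((L : ℝ) ^ d)⁻¹ * ∑ μ : Fin d, ∑ x : Tor (fine L N), ‖cdV (fine L N) R' W x μ μ‖ ^ 2
          + d * m ^ 2 * ((L : ℝ) ^ d)⁻¹ * nsqV (fine L N) W) := by
  have hL : (0 : ℝ) < L := by exact_mod_cast Nat.pos_of_ne_zero (NeZero.ne L)
  have hLd : (0 : ℝ) < (L : ℝ) ^ d := by positivity
  -- the three legs of the pointwise bound
  set F₂ : Fin d → Tor (fine L N) → E := fun μ z => cdV (fine L N) R' (fun w ν => cdV (fine L N) R' W w μ ν) z μ μ with hF₂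
  set F₁ : Fin d → Tor (fine L N) → E := fun μ z => cdV (fine L N) R' W z μ μ with hF₁
  set A : Tor N → ℝ := fun y => ∑ μ : Fin d, ∑ j : Fin d → Fin L, ∑ t : Fin L, ∑ r ∈ range L,
    ‖F₂ μ (bpt L N (y - unitVec N μ) j + tstep (fine L N) μ t + tstep (fine L N) μ r)‖ with hA
  set B : Tor N → ℝ := fun y => ∑ μ : Fin d, ∑ j : Fin d → Fin L, ‖F₁ μ (bpt L N y j - unitVec (fine L N) μ)‖ with hB
  set C : Tor N → ℝ := fun y => ∑ μ : Fin d, ∑ j : Fin d → Fin L, ∑ t : Fin L, ‖W (bpt L N y j + tstep (fine L N) μ t) μ‖ with hC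
  -- §a pointwise: `‖diff y‖ ≤ (L^{d+1})⁻¹ (2L·A y + L·L·m·B y + m·C y)`
  have hpt : ∀ y, ‖divV N Rc (QvL L N (lineT L N T₀ R') W) y - (L : ℂ) • Qcv L N T₀ (divV (fine L N) R' W) y‖
      ≤ ((L : ℝ) ^ (d + 1))⁻¹ * (2 * (L : ℝ) * A y + (L : ℝ) * L * m * B y + m * C y) := fun y => by
    refine (norm_divAvg_cov_le L N hRc hR' hT₀ hmis W y).trans (le_of_eq ?_)
    congr 1
    simp only [hA, hB, hC, hF₂, hF₁, sum_add_distrib, mul_sum, sum_const, Finset.card_univ, Fintype.card_fin, nsmul_eq_mul]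
    ring
  -- §b Cauchy–Schwarz for each leg
  have hcsA : ∀ y, A y ^ 2 ≤ d * ((L : ℝ) ^ d * (L * (L * ∑ μ : Fin d, ∑ j : Fin d → Fin L, ∑ t : Fin L, ∑ r ∈ range L,
      ‖F₂ μ (bpt L N (y - unitVec N μ) j + tstep (fine L N) μ t + tstep (fine L N) μ r)‖ ^ 2))) := fun y => by
    have c1 := sq_sum_le_card_mul Finset.univ (fun μ : Fin d => ∑ j : Fin d → Fin L, ∑ t : Fin L, ∑ r ∈ range L,
      ‖F₂ μ (bpt L N (y - unitVec N μ) j + tstep (fine L N) μ t + tstep (fine L N) μ r)‖)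
    rw [Finset.card_univ, Fintype.card_fin] at c1
    have c2 : ∀ μ : Fin d, (∑ j : Fin d → Fin L, ∑ t : Fin L, ∑ r ∈ range L, ‖F₂ μ (bpt L N (y - unitVec N μ) j + tstep (fine L N) μ t + tstep (fine L N) μ r)‖) ^ 2
        ≤ (L : ℝ) ^ d * ∑ j : Fin d → Fin L, (∑ t : Fin L, ∑ r ∈ range L, ‖F₂ μ (bpt L N (y - unitVec N μ) j + tstep (fine L N) μ t + tstep (fine L N) μ r)‖) ^ 2 := by
      intro μ
      have c := sq_sum_le_card_mul Finset.univ (fun j : Fin d → Fin L => ∑ t : Fin L, ∑ r ∈ range L,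
        ‖F₂ μ (bpt L N (y - unitVec N μ) j + tstep (fine L N) μ t + tstep (fine L N) μ r)‖)
      rwa [Finset.card_univ, Fintype.card_fun, Fintype.card_fin, Fintype.card_fin, Nat.cast_pow] at c
    have c3 : ∀ (μ : Fin d) (j : Fin d → Fin L), (∑ t : Fin L, ∑ r ∈ range L, ‖F₂ μ (bpt L N (y - unitVec N μ) j + tstep (fine L N) μ t + tstep (fine L N) μ r)‖) ^ 2
        ≤ (L : ℝ) * ∑ t : Fin L, (∑ r ∈ range L, ‖F₂ μ (bpt L N (y - unitVec N μ) j + tstep (fine L N) μ t + tstep (fine L N) μ r)‖) ^ 2 := by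
      intro μ j
      have c := sq_sum_le_card_mul Finset.univ (fun t : Fin L => ∑ r ∈ range L, ‖F₂ μ (bpt L N (y - unitVec N μ) j + tstep (fine L N) μ t + tstep (fine L N) μ r)‖)
      rwa [Finset.card_univ, Fintype.card_fin] at c
    have c4 : ∀ (μ : Fin d) (j : Fin d → Fin L) (t : Fin L), (∑ r ∈ range L, ‖F₂ μ (bpt L N (y - unitVec N μ) j + tstep (fine L N) μ t + tstep (fine L N) μ r)‖) ^ 2
        ≤ (L : ℝ) * ∑ r ∈ range L, ‖F₂ μ (bpt L N (y - unitVec N μ) j + tstep (fine L N) μ t + tstep (fine L N) μ r)‖ ^ 2 := by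
      intro μ j t
      have c := sq_sum_le_card_mul (range L) (fun r => ‖F₂ μ (bpt L N (y - unitVec N μ) j + tstep (fine L N) μ t + tstep (fine L N) μ r)‖)
      rwa [card_range] at c
    calc A y ^ 2 ≤ (d : ℝ) * ∑ μ : Fin d, (∑ j : Fin d → Fin L, ∑ t : Fin L, ∑ r ∈ range L, ‖F₂ μ (bpt L N (y - unitVec N μ) j + tstep (fine L N) μ t + tstep (fine L N) μ r)‖) ^ 2 := c1
      _ ≤ (d : ℝ) * ∑ μ : Fin d, ((L : ℝ) ^ d * ∑ j : Fin d → Fin L, ((L : ℝ) * ∑ t : Fin L, ((L : ℝ) * ∑ r ∈ range L,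
            ‖F₂ μ (bpt L N (y - unitVec N μ) j + tstep (fine L N) μ t + tstep (fine L N) μ r)‖ ^ 2))) := by
          gcongr with μ _
          refine (c2 μ).trans ?_
          gcongr with j _
          refine (c3 μ j).trans ?_
          gcongr with t _
          exact c4 μ j t
      _ = _ := by simp only [mul_sum]
  have hcsB : ∀ y, B y ^ 2 ≤ d * ((L : ℝ) ^ d * ∑ μ : Fin d, ∑ j : Fin d → Fin L, ‖F₁ μ (bpt L N y j - unitVec (fine L N) μ)‖ ^ 2) := fun y => by
    have c1 := sq_sum_le_card_mul Finset.univ (fun μ : Fin d => ∑ j : Fin d → Fin L, ‖F₁ μ (bpt L N y j - unitVec (fine L N) μ)‖)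
    rw [Finset.card_univ, Fintype.card_fin] at c1
    have c2 : ∀ μ : Fin d, (∑ j : Fin d → Fin L, ‖F₁ μ (bpt L N y j - unitVec (fine L N) μ)‖) ^ 2
        ≤ (L : ℝ) ^ d * ∑ j : Fin d → Fin L, ‖F₁ μ (bpt L N y j - unitVec (fine L N) μ)‖ ^ 2 := by
      intro μ
      have c := sq_sum_le_card_mul Finset.univ (fun j : Fin d → Fin L => ‖F₁ μ (bpt L N y j - unitVec (fine L N) μ)‖)
      rwa [Finset.card_univ, Fintype.card_fun, Fintype.card_fin, Fintype.card_fin, Nat.cast_pow] at c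
    calc B y ^ 2 ≤ (d : ℝ) * ∑ μ : Fin d, (∑ j : Fin d → Fin L, ‖F₁ μ (bpt L N y j - unitVec (fine L N) μ)‖) ^ 2 := c1
      _ ≤ (d : ℝ) * ∑ μ : Fin d, ((L : ℝ) ^ d * ∑ j : Fin d → Fin L, ‖F₁ μ (bpt L N y j - unitVec (fine L N) μ)‖ ^ 2) := by
          gcongr with μ _; exact c2 μ
      _ = _ := by simp only [mul_sum]
  have hcsC : ∀ y, C y ^ 2 ≤ d * ((L : ℝ) ^ d * (L * ∑ μ : Fin d, ∑ j : Fin d → Fin L, ∑ t : Fin L, ‖W (bpt L N y j + tstep (fine L N) μ t) μ‖ ^ 2)) := fun y => by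
    have c1 := sq_sum_le_card_mul Finset.univ (fun μ : Fin d => ∑ j : Fin d → Fin L, ∑ t : Fin L, ‖W (bpt L N y j + tstep (fine L N) μ t) μ‖)
    rw [Finset.card_univ, Fintype.card_fin] at c1
    have c2 : ∀ μ : Fin d, (∑ j : Fin d → Fin L, ∑ t : Fin L, ‖W (bpt L N y j + tstep (fine L N) μ t) μ‖) ^ 2
        ≤ (L : ℝ) ^ d * ∑ j : Fin d → Fin L, (∑ t : Fin L, ‖W (bpt L N y j + tstep (fine L N) μ t) μ‖) ^ 2 := by
      intro μ
      have c := sq_sum_le_card_mul Finset.univ (fun j : Fin d → Fin L => ∑ t : Fin L, ‖W (bpt L N y j + tstep (fine L N) μ t) μ‖)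
      rwa [Finset.card_univ, Fintype.card_fun, Fintype.card_fin, Fintype.card_fin, Nat.cast_pow] at c
    have c3 : ∀ (μ : Fin d) (j : Fin d → Fin L), (∑ t : Fin L, ‖W (bpt L N y j + tstep (fine L N) μ t) μ‖) ^ 2
        ≤ (L : ℝ) * ∑ t : Fin L, ‖W (bpt L N y j + tstep (fine L N) μ t) μ‖ ^ 2 := by
      intro μ j
      have c := sq_sum_le_card_mul Finset.univ (fun t : Fin L => ‖W (bpt L N y j + tstep (fine L N) μ t) μ‖)
      rwa [Finset.card_univ, Fintype.card_fin] at c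
    calc C y ^ 2 ≤ (d : ℝ) * ∑ μ : Fin d, (∑ j : Fin d → Fin L, ∑ t : Fin L, ‖W (bpt L N y j + tstep (fine L N) μ t) μ‖) ^ 2 := c1
      _ ≤ (d : ℝ) * ∑ μ : Fin d, ((L : ℝ) ^ d * ∑ j : Fin d → Fin L, ((L : ℝ) * ∑ t : Fin L, ‖W (bpt L N y j + tstep (fine L N) μ t) μ‖ ^ 2)) := by
          gcongr with μ _
          refine (c2 μ).trans ?_
          gcongr with j _
          exact c3 μ j
      _ = _ := by simp only [mul_sum]
  -- §c summing over `y`: block bijection + translation invariance for each leg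
  have hsumA : ∑ y : Tor N, ∑ μ : Fin d, ∑ j : Fin d → Fin L, ∑ t : Fin L, ∑ r ∈ range L,
        ‖F₂ μ (bpt L N (y - unitVec N μ) j + tstep (fine L N) μ t + tstep (fine L N) μ r)‖ ^ 2
      = (L : ℝ) * L * ∑ μ : Fin d, ∑ x : Tor (fine L N), ‖F₂ μ x‖ ^ 2 := by
    calc _ = ∑ μ : Fin d, ∑ t : Fin L, ∑ r ∈ range L, ∑ y : Tor N, ∑ j : Fin d → Fin L,
            ‖F₂ μ (bpt L N (y - unitVec N μ) j + (tstep (fine L N) μ t + tstep (fine L N) μ r))‖ ^ 2 := by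
          rw [Finset.sum_comm]
          refine sum_congr rfl fun μ _ => ?_
          calc ∑ y : Tor N, ∑ j : Fin d → Fin L, ∑ t : Fin L, ∑ r ∈ range L, ‖F₂ μ (bpt L N (y - unitVec N μ) j + tstep (fine L N) μ t + tstep (fine L N) μ r)‖ ^ 2
              = ∑ y : Tor N, ∑ t : Fin L, ∑ r ∈ range L, ∑ j : Fin d → Fin L, ‖F₂ μ (bpt L N (y - unitVec N μ) j + (tstep (fine L N) μ t + tstep (fine L N) μ r))‖ ^ 2 := by
                refine sum_congr rfl fun y _ => ?_
                rw [Finset.sum_comm]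
                refine sum_congr rfl fun t _ => ?_
                rw [Finset.sum_comm]
                refine sum_congr rfl fun r _ => sum_congr rfl fun j _ => by rw [add_assoc]
            _ = _ := by
                rw [Finset.sum_comm]
                refine sum_congr rfl fun t _ => ?_
                rw [Finset.sum_comm]
      _ = ∑ μ : Fin d, ∑ _t : Fin L, ∑ _r ∈ range L, ∑ x : Tor (fine L N), ‖F₂ μ x‖ ^ 2 := by
          refine sum_congr rfl fun μ _ => sum_congr rfl fun t _ => sum_congr rfl fun r _ => ?_
          -- reindex `y ↦ y − e_μ`, then the block bijection with a translation
          calc ∑ y : Tor N, ∑ j : Fin d → Fin L, ‖F₂ μ (bpt L N (y - unitVec N μ) j + (tstep (fine L N) μ t + tstep (fine L N) μ r))‖ ^ 2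
              = ∑ y : Tor N, ∑ j : Fin d → Fin L, ‖F₂ μ (bpt L N y j + (tstep (fine L N) μ t + tstep (fine L N) μ r))‖ ^ 2 :=
                Fintype.sum_equiv (Equiv.subRight (unitVec N μ)) _ _ (fun y => rfl)
            _ = _ := sum_blocks_translate L N (fun x => ‖F₂ μ x‖ ^ 2) _
      _ = _ := by
          simp only [sum_const, card_range, Finset.card_univ, Fintype.card_fin, nsmul_eq_mul]
          rw [mul_sum]
          exact sum_congr rfl fun μ _ => by ring
  have hsumB : ∑ y : Tor N, ∑ μ : Fin d, ∑ j : Fin d → Fin L, ‖F₁ μ (bpt L N y j - unitVec (fine L N) μ)‖ ^ 2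
      = ∑ μ : Fin d, ∑ x : Tor (fine L N), ‖F₁ μ x‖ ^ 2 := by
    rw [Finset.sum_comm]
    refine sum_congr rfl fun μ _ => ?_
    have h := sum_blocks_translate L N (fun x => ‖F₁ μ x‖ ^ 2) (-unitVec (fine L N) μ)
    simp only [← sub_eq_add_neg] at h
    exact h
  have hsumC : ∑ y : Tor N, ∑ μ : Fin d, ∑ j : Fin d → Fin L, ∑ t : Fin L, ‖W (bpt L N y j + tstep (fine L N) μ t) μ‖ ^ 2
      = (L : ℝ) * nsqV (fine L N) W := by
    calc _ = ∑ μ : Fin d, ∑ t : Fin L, ∑ y : Tor N, ∑ j : Fin d → Fin L, ‖W (bpt L N y j + tstep (fine L N) μ t) μ‖ ^ 2 := by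
          rw [Finset.sum_comm]
          refine sum_congr rfl fun μ _ => ?_
          calc ∑ y : Tor N, ∑ j : Fin d → Fin L, ∑ t : Fin L, ‖W (bpt L N y j + tstep (fine L N) μ t) μ‖ ^ 2
              = ∑ y : Tor N, ∑ t : Fin L, ∑ j : Fin d → Fin L, ‖W (bpt L N y j + tstep (fine L N) μ t) μ‖ ^ 2 :=
                sum_congr rfl fun y _ => Finset.sum_comm
            _ = _ := Finset.sum_comm
      _ = ∑ μ : Fin d, ∑ _t : Fin L, ∑ x : Tor (fine L N), ‖W x μ‖ ^ 2 :=
          sum_congr rfl fun μ _ => sum_congr rfl fun t _ => sum_blocks_translate L N (fun x => ‖W x μ‖ ^ 2) _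
      _ = _ := by
          simp only [sum_const, Finset.card_univ, Fintype.card_fin, nsmul_eq_mul]
          unfold nsqV
          rw [Finset.sum_comm, mul_sum]
  -- §d the second differences are one diagonal entry of `hessV`
  have hdiag : ∑ μ : Fin d, ∑ x : Tor (fine L N), ‖F₂ μ x‖ ^ 2 ≤ hessV (fine L N) R' W := by
    simp only [hF₂]
    exact sum_diag_le_hessV R' W
  -- §e assemble
  calc ∑ y, ‖divV N Rc (QvL L N (lineT L N T₀ R') W) y - (L : ℂ) • Qcv L N T₀ (divV (fine L N) R' W) y‖ ^ 2
      ≤ ∑ y : Tor N, (((L : ℝ) ^ (d + 1))⁻¹ * (2 * (L : ℝ) * A y + (L : ℝ) * L * m * B y + m * C y)) ^ 2 :=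
        sum_le_sum fun y _ => pow_le_pow_left₀ (norm_nonneg _) (hpt y) 2
    _ ≤ ∑ y : Tor N, (((L : ℝ) ^ (d + 1))⁻¹) ^ 2 * (3 * ((2 * (L : ℝ)) ^ 2 * A y ^ 2 + ((L : ℝ) * L * m) ^ 2 * B y ^ 2 + m ^ 2 * C y ^ 2)) := by
        refine sum_le_sum fun y _ => ?_
        rw [mul_pow]
        refine mul_le_mul_of_nonneg_left ?_ (sq_nonneg _)
        -- `(a + b + c)² ≤ 3(a² + b² + c²)` (the tree's `MatomakiRadziwillL14.sq_add_three_le`, inlined)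
        have h : ∀ a b c : ℝ, (a + b + c) ^ 2 ≤ 3 * (a ^ 2 + b ^ 2 + c ^ 2) := fun a b c => by
          nlinarith [sq_nonneg (a - b), sq_nonneg (b - c), sq_nonneg (a - c)]
        refine (h (2 * (L : ℝ) * A y) ((L : ℝ) * L * m * B y) (m * C y)).trans (le_of_eq ?_)
        ring
    _ ≤ ∑ y : Tor N, (((L : ℝ) ^ (d + 1))⁻¹) ^ 2 * (3 * ((2 * (L : ℝ)) ^ 2 * (d * ((L : ℝ) ^ d * (L * (L * ∑ μ : Fin d, ∑ j : Fin d → Fin L, ∑ t : Fin L, ∑ r ∈ range L,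
            ‖F₂ μ (bpt L N (y - unitVec N μ) j + tstep (fine L N) μ t + tstep (fine L N) μ r)‖ ^ 2))))
          + ((L : ℝ) * L * m) ^ 2 * (d * ((L : ℝ) ^ d * ∑ μ : Fin d, ∑ j : Fin d → Fin L, ‖F₁ μ (bpt L N y j - unitVec (fine L N) μ)‖ ^ 2))
          + m ^ 2 * (d * ((L : ℝ) ^ d * (L * ∑ μ : Fin d, ∑ j : Fin d → Fin L, ∑ t : Fin L, ‖W (bpt L N y j + tstep (fine L N) μ t) μ‖ ^ 2))))) := by
        gcongr with y _
        · exact hcsA y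
        · exact hcsB y
        · exact hcsC y
    _ = (((L : ℝ) ^ (d + 1))⁻¹) ^ 2 * (3 * ((2 * (L : ℝ)) ^ 2 * (d * ((L : ℝ) ^ d * (L * (L * ((L : ℝ) * L * ∑ μ : Fin d, ∑ x : Tor (fine L N), ‖F₂ μ x‖ ^ 2)))))
          + ((L : ℝ) * L * m) ^ 2 * (d * ((L : ℝ) ^ d * ∑ μ : Fin d, ∑ x : Tor (fine L N), ‖F₁ μ x‖ ^ 2))
          + m ^ 2 * (d * ((L : ℝ) ^ d * (L * ((L : ℝ) * nsqV (fine L N) W)))))) := by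
        rw [← hsumA, ← hsumB, ← hsumC]
        simp only [mul_sum, sum_add_distrib, mul_add]
    _ ≤ (((L : ℝ) ^ (d + 1))⁻¹) ^ 2 * (3 * ((2 * (L : ℝ)) ^ 2 * (d * ((L : ℝ) ^ d * (L * (L * ((L : ℝ) * L * hessV (fine L N) R' W)))))
          + ((L : ℝ) * L * m) ^ 2 * (d * ((L : ℝ) ^ d * ∑ μ : Fin d, ∑ x : Tor (fine L N), ‖F₁ μ x‖ ^ 2))
          + m ^ 2 * (d * ((L : ℝ) ^ d * (L * ((L : ℝ) * nsqV (fine L N) W)))))) := by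
        gcongr
    _ = _ := by
        simp only [hF₁]
        field_simp
        ring

/-! ## §2 END units: the `hDIV` binder of file 5 with background -/

omit [InnerProductSpace ℂ E] [CompleteSpace E] hN [NeZero L] in
/-- `a²x + b²y + c²z ≤ (a + b + c)²·(x + y + z)` for nonnegative reals. [folklore] -/
theorem weighted_le_sq_sum {a b c x y z : ℝ} (ha : 0 ≤ a) (hb : 0 ≤ b) (hc : 0 ≤ c) (hx : 0 ≤ x) (hy : 0 ≤ y) (hz : 0 ≤ z) :
    a ^ 2 * x + b ^ 2 * y + c ^ 2 * z ≤ (a + b + c) ^ 2 * (x + y + z) := by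
  nlinarith [mul_nonneg ha hb, mul_nonneg hb hc, mul_nonneg ha hc, mul_nonneg (mul_nonneg ha hb) hx, mul_nonneg (mul_nonneg ha hb) hy,
    mul_nonneg (mul_nonneg ha hb) hz, mul_nonneg (mul_nonneg hb hc) hx, mul_nonneg (mul_nonneg hb hc) hy, mul_nonneg (mul_nonneg hb hc) hz,
    mul_nonneg (mul_nonneg ha hc) hx, mul_nonneg (mul_nonneg ha hc) hy, mul_nonneg (mul_nonneg ha hc) hz,
    mul_nonneg (sq_nonneg a) hy, mul_nonneg (sq_nonneg a) hz, mul_nonneg (sq_nonneg b) hx, mul_nonneg (sq_nonneg b) hz,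
    mul_nonneg (sq_nonneg c) hx, mul_nonneg (sq_nonneg c) hy]

/-- **DIV-AVG WITH BACKGROUND IN THE END's UNITS** (`N := fine n M`; unitary data, product line carriers, line mismatch `m`):
`√((n^d)⁻¹n²)·‖toLp(div_{Rc}(Q_T W)) − toLp(L•Q_{T₀′}(div_{R′}W))‖ ≤ √(3d)·(2n⁻¹ + m + n·m)·√( ((nL)⁴∕(nL)^d)·hessV R′ W + ((nL)²∕(nL)^d)·Σ_μΣ_x‖D_μW_μ‖² + qVV W )`
— the `hDIV` binder of `VariationalVectorAvgGProjG.avgG_projG_of_divAvg` with `ε_D = √(3d)·(2n⁻¹ + m + n·m)` and `ρ_D = HESS♯ + GRAD♯ + qVV`. [folklore] -/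
theorem divAvg_cov (n : ℕ) [NeZero n] (M : Fin d → ℕ) [∀ μ, NeZero (M μ)]
    {Rc : Tor (fine n M) → Fin d → (E →L[ℂ] E)} {R' : Tor (fine L (fine n M)) → Fin d → (E →L[ℂ] E)} {T₀ : Tor (fine L (fine n M)) → (E →L[ℂ] E)}
    (hRc : ∀ y μ, Rc y μ ∈ unitary (E →L[ℂ] E)) (hR' : ∀ x μ, R' x μ ∈ unitary (E →L[ℂ] E)) (hT₀ : ∀ x, T₀ x ∈ unitary (E →L[ℂ] E))
    {m : ℝ} (hm0 : 0 ≤ m) (hmis : ∀ y μ j, ‖misv L (fine n M) Rc R' T₀ y μ j‖ ≤ m) (W : Tor (fine L (fine n M)) → Fin d → E) :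
    Real.sqrt (((n : ℝ) ^ d)⁻¹ * (n : ℝ) ^ 2)
        * ‖toLp 2 (divV (fine n M) Rc (QvL L (fine n M) (lineT L (fine n M) T₀ R') W))
            - toLp 2 (fun y => (L : ℂ) • Qcv L (fine n M) T₀ (divV (fine L (fine n M)) R' W) y)‖
      ≤ (Real.sqrt (3 * d) * (2 * (n : ℝ)⁻¹ + m + n * m))
        * Real.sqrt ((((n : ℝ) * L) ^ 4 / ((n : ℝ) * L) ^ d) * hessV (fine L (fine n M)) R' W
            + (((n : ℝ) * L) ^ 2 / ((n : ℝ) * L) ^ d) * ∑ μ : Fin d, ∑ x : Tor (fine L (fine n M)), ‖cdV (fine L (fine n M)) R' W x μ μ‖ ^ 2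
            + qVV n L M W) := by
  have hn : (0 : ℝ) < n := by exact_mod_cast Nat.pos_of_ne_zero (NeZero.ne n)
  have hL : (0 : ℝ) < L := by exact_mod_cast Nat.pos_of_ne_zero (NeZero.ne L)
  have hH : 0 ≤ hessV (fine L (fine n M)) R' W := by unfold hessV; exact sum_nonneg fun ν _ => hessv_nonneg _ _ _
  have hG : 0 ≤ ∑ μ : Fin d, ∑ x : Tor (fine L (fine n M)), ‖cdV (fine L (fine n M)) R' W x μ μ‖ ^ 2 := by positivity
  have hQ : 0 ≤ qVV n L M W := VariationalVectorForm.qVV_nonneg n L M W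
  set HS : ℝ := (((n : ℝ) * L) ^ 4 / ((n : ℝ) * L) ^ d) * hessV (fine L (fine n M)) R' W with hHS
  set GS : ℝ := (((n : ℝ) * L) ^ 2 / ((n : ℝ) * L) ^ d) * ∑ μ : Fin d, ∑ x : Tor (fine L (fine n M)), ‖cdV (fine L (fine n M)) R' W x μ μ‖ ^ 2 with hGS
  have hHS0 : 0 ≤ HS := by positivity
  have hGS0 : 0 ≤ GS := by positivity
  have hsq := divAvg_cov_sq_le L (fine n M) hRc hR' hT₀ hmis W
  -- compare squares
  have hlhs0 : 0 ≤ Real.sqrt (((n : ℝ) ^ d)⁻¹ * (n : ℝ) ^ 2)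
      * ‖toLp 2 (divV (fine n M) Rc (QvL L (fine n M) (lineT L (fine n M) T₀ R') W))
          - toLp 2 (fun y => (L : ℂ) • Qcv L (fine n M) T₀ (divV (fine L (fine n M)) R' W) y)‖ := by positivity
  have hrhs0 : 0 ≤ (Real.sqrt (3 * d) * (2 * (n : ℝ)⁻¹ + m + n * m)) * Real.sqrt (HS + GS + qVV n L M W) := by positivity
  rw [← Real.sqrt_sq hlhs0, ← Real.sqrt_sq hrhs0]
  refine Real.sqrt_le_sqrt ?_
  have hA : 0 ≤ ((n : ℝ) ^ d)⁻¹ * (n : ℝ) ^ 2 := by positivity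
  rw [mul_pow, mul_pow, mul_pow, Real.sq_sqrt hA, Real.sq_sqrt (by positivity), Real.sq_sqrt (by positivity), ← toLp_sub, norm_toLp_sq]
  have e : ∑ y, ‖(divV (fine n M) Rc (QvL L (fine n M) (lineT L (fine n M) T₀ R') W)
        - fun y => (L : ℂ) • Qcv L (fine n M) T₀ (divV (fine L (fine n M)) R' W) y) y‖ ^ 2
      = ∑ y, ‖divV (fine n M) Rc (QvL L (fine n M) (lineT L (fine n M) T₀ R') W) y - (L : ℂ) • Qcv L (fine n M) T₀ (divV (fine L (fine n M)) R' W) y‖ ^ 2 := rfl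
  rw [e]
  -- the lattice bound in END units: `(n^d)⁻¹n²·3(…) = 3·(4n⁻²·HS + m²·GS + (nm)²·qVV)`
  have hunits : ((n : ℝ) ^ d)⁻¹ * (n : ℝ) ^ 2 * (3 * (4 * d * (L : ℝ) ^ 4 * ((L : ℝ) ^ d)⁻¹ * hessV (fine L (fine n M)) R' W
          + d * m ^ 2 * (L : ℝ) ^ 2 * ((L : ℝ) ^ d)⁻¹ * ∑ μ : Fin d, ∑ x : Tor (fine L (fine n M)), ‖cdV (fine L (fine n M)) R' W x μ μ‖ ^ 2
          + d * m ^ 2 * ((L : ℝ) ^ d)⁻¹ * nsqV (fine L (fine n M)) W))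
      = 3 * d * ((2 * (n : ℝ)⁻¹) ^ 2 * HS + m ^ 2 * GS + ((n : ℝ) * m) ^ 2 * qVV n L M W) := by
    rw [hHS, hGS]
    unfold qVV
    have h1 : ((n : ℝ) * L) ^ 4 / ((n : ℝ) * L) ^ d = (n : ℝ) ^ 4 * (L : ℝ) ^ 4 * (((n : ℝ) ^ d)⁻¹ * ((L : ℝ) ^ d)⁻¹) := by
      rw [mul_pow, mul_pow, div_eq_mul_inv, mul_inv]
    have h2 : ((n : ℝ) * L) ^ 2 / ((n : ℝ) * L) ^ d = (n : ℝ) ^ 2 * (L : ℝ) ^ 2 * (((n : ℝ) ^ d)⁻¹ * ((L : ℝ) ^ d)⁻¹) := by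
      rw [mul_pow, mul_pow, div_eq_mul_inv, mul_inv]
    have h3 : (((n : ℝ) * L) ^ d)⁻¹ = ((n : ℝ) ^ d)⁻¹ * ((L : ℝ) ^ d)⁻¹ := by rw [mul_pow, mul_inv]
    rw [h1, h2, h3]
    field_simp
    ring
  calc ((n : ℝ) ^ d)⁻¹ * (n : ℝ) ^ 2 * ∑ y, ‖divV (fine n M) Rc (QvL L (fine n M) (lineT L (fine n M) T₀ R') W) y
          - (L : ℂ) • Qcv L (fine n M) T₀ (divV (fine L (fine n M)) R' W) y‖ ^ 2
      ≤ ((n : ℝ) ^ d)⁻¹ * (n : ℝ) ^ 2 * (3 * (4 * d * (L : ℝ) ^ 4 * ((L : ℝ) ^ d)⁻¹ * hessV (fine L (fine n M)) R' W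
          + d * m ^ 2 * (L : ℝ) ^ 2 * ((L : ℝ) ^ d)⁻¹ * ∑ μ : Fin d, ∑ x : Tor (fine L (fine n M)), ‖cdV (fine L (fine n M)) R' W x μ μ‖ ^ 2
          + d * m ^ 2 * ((L : ℝ) ^ d)⁻¹ * nsqV (fine L (fine n M)) W)) := mul_le_mul_of_nonneg_left hsq hA
    _ = 3 * d * ((2 * (n : ℝ)⁻¹) ^ 2 * HS + m ^ 2 * GS + ((n : ℝ) * m) ^ 2 * qVV n L M W) := hunits
    _ ≤ 3 * d * ((2 * (n : ℝ)⁻¹ + m + n * m) ^ 2 * (HS + GS + qVV n L M W)) :=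
        mul_le_mul_of_nonneg_left (weighted_le_sq_sum (by positivity) hm0 (by positivity) hHS0 hGS0 hQ) (by positivity)
    _ = 3 * (d : ℝ) * (2 * (n : ℝ)⁻¹ + m + n * m) ^ 2 * (HS + GS + qVV n L M W) := by ring

end Summit.QuantumFields.BalabanUV.T4Continuum.VariationalVectorDivAvgCovariantSum

end
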